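import Literature.Probability.LatticeModels.LatticePotentialKernel
import Literature.Probability.LatticeModels.LatticeGreenHeatKernel
import HarnessLib

/-!
# The heat-kernel representation of the planar potential kernel

Topic `Literature/Probability/LatticeModels`; companion of `LatticePotentialKernel.lean` (the
potential kernel `a(x) = (2π)^{-d}∫_{[-π,π]^d} (1 - cos (p·x))/ε(p) dp`, `Δ a = 2δ₀`) and of
`LatticeGreenHeatKernel.lean` (product structure of the heat kernel of `ε`,
`∫ cos(p·x) e^{-tε(p)} dp = (2π)^d ∏ᵢ q_t(xᵢ)`, `q_t = srwHeatKernel t` the transition function of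
the rate-one continuous-time simple random walk on `ℤ`). PROVED here, for `d = 2`:

* **`latticePotentialKernel_two_eq_integral`** —
  `a(x) = ∫₀^∞ (q_t(0)² - q_t(x₀) q_t(x₁)) dt`, the integrand being integrable on `(0, ∞)`.

This is the time-integral form `a(x) = ∫₀^∞ (p_t(0,0) - p_t(0,x)) dt` of the potential kernel of
the continuous-time planar walk (Lawler–Limic 2010, §4.4.1, (4.34) with continuous time, whose
occupation densities agree with the discrete-time ones), from which the asymptotics
`a(x) = (1/π) log|x| + κ + o(1)` are derived in the companion file by the Gaussian local limit
theorem of `SRWHeatKernelLCLT.lean`. Proof: `1/ε(p) = ∫₀^∞ e^{-tε(p)} dt` (`p ≠ 0`) makes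
`(1 - cos(p·x))/ε(p) = ∫₀^∞ (1 - cos(p·x)) e^{-tε(p)} dt` with a NONNEGATIVE integrand, so Tonelli
on `[-π,π]² × (0,∞)` is legitimate (the `p`-integral of the `t`-integrals is the bounded-integrand
integral `∫ (1 - cos)/ε dp < ∞` of `integrableOn_potentialIntegrand`), and for fixed `t` the
`p`-integral is `(2π)²(q_t(0)² - q_t(x₀)q_t(x₁))` by the product structure (at `x` and at `0`).
Everything is proved; no named fact.

## References

* G. F. Lawler, V. Limic, *Random Walk: A Modern Introduction* (2010), §4.4.1 (potential kernel),
  §4.3 (Green function as time integral of the heat kernel) [LawlerLimic2010].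
-/

noncomputable section

open MeasureTheory Set Filter
open scoped Real Topology

namespace Literature.Probability.LatticeModels

/-- The `p`-integral of `(1 - cos (p·x)) e^{-tε(p)}` over `[-π,π]²` is
`(2π)² (q_t(0)² - q_t(x₀) q_t(x₁))` (product structure of the heat kernel at `x` and at `0`).
[folklore] -/
theorem setIntegral_one_sub_cos_mul_exp_two (t : ℝ) (x : Site 2) :
    ∫ p in brillouin 2, (1 - Real.cos (∑ i, p i * (x i : ℝ))) * Real.exp (-(t * dispersion p)) =
      (2 * π) ^ 2 * (srwHeatKernel t 0 ^ 2 - srwHeatKernel t (x 0) * srwHeatKernel t (x 1)) := by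
  have hx := setIntegral_cos_mul_exp_eq_prod t x
  have h0 := setIntegral_cos_mul_exp_eq_prod t (0 : Site 2)
  simp only [Pi.zero_apply, Int.cast_zero, mul_zero, Finset.sum_const_zero, Real.cos_zero,
    one_mul] at h0
  rw [Fin.prod_univ_two] at hx h0
  have hεc : Continuous (dispersion : (Fin 2 → ℝ) → ℝ) := continuous_dispersion 2
  have hexp_int : IntegrableOn (fun p : Fin 2 → ℝ => Real.exp (-(t * dispersion p))) (brillouin 2) :=
    (Real.continuous_exp.comp (continuous_const.mul hεc).neg).continuousOn.integrableOn_compact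
      (isCompact_brillouin 2)
  have hcos_int : IntegrableOn
      (fun p : Fin 2 → ℝ => Real.cos (∑ i, p i * (x i : ℝ)) * Real.exp (-(t * dispersion p)))
      (brillouin 2) := by
    refine Continuous.continuousOn ?_ |>.integrableOn_compact (isCompact_brillouin 2)
    fun_prop
  have hsplit : (fun p : Fin 2 → ℝ => (1 - Real.cos (∑ i, p i * (x i : ℝ))) *
      Real.exp (-(t * dispersion p))) = fun p => Real.exp (-(t * dispersion p)) -
        Real.cos (∑ i, p i * (x i : ℝ)) * Real.exp (-(t * dispersion p)) := by
    funext p; ring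
  rw [hsplit, integral_sub hexp_int hcos_int, h0, hx]
  ring

/-- **The heat-kernel representation of the planar potential kernel**:
`a(x) = ∫₀^∞ (q_t(0)² - q_t(x₀) q_t(x₁)) dt` for every `x ∈ ℤ²`, the integrand being integrable
on `(0, ∞)` (continuous-time form of Lawler–Limic 2010, (4.34); Tonelli for the nonnegative
integrand `(1 - cos(p·x)) e^{-tε(p)}` on `[-π,π]² × (0,∞)` and the product structure of the heat
kernel). [cite: LawlerLimic2010, §4.4.1 eq. (4.34)] -/
theorem latticePotentialKernel_two_eq_integral (x : Site 2) :
    IntegrableOn (fun t : ℝ => srwHeatKernel t 0 ^ 2 - srwHeatKernel t (x 0) * srwHeatKernel t (x 1))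
        (Ioi 0) ∧
      latticePotentialKernel 2 x =
        ∫ t in Ioi (0 : ℝ), (srwHeatKernel t 0 ^ 2 - srwHeatKernel t (x 0) * srwHeatKernel t (x 1)) := by
  set μ : Measure (Fin 2 → ℝ) := volume.restrict (brillouin 2) with hμ
  set ν : Measure ℝ := volume.restrict (Ioi (0 : ℝ)) with hν
  set θ : (Fin 2 → ℝ) → ℝ := fun p => ∑ i, p i * (x i : ℝ) with hθ
  set F : (Fin 2 → ℝ) × ℝ → ℝ :=
    fun q => (1 - Real.cos (θ q.1)) * Real.exp (-(q.2 * dispersion q.1)) with hF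
  have hθc : Continuous θ := by simp only [hθ]; fun_prop
  have hεc : Continuous (dispersion : (Fin 2 → ℝ) → ℝ) := continuous_dispersion 2
  have hF_cont : Continuous F :=
    (continuous_const.sub (Real.continuous_cos.comp (hθc.comp continuous_fst))).mul
      (Real.continuous_exp.comp ((continuous_snd.mul (hεc.comp continuous_fst)).neg))
  have hF_meas : AEStronglyMeasurable F (μ.prod ν) := hF_cont.aestronglyMeasurable
  have hF_nonneg : ∀ q, 0 ≤ F q := fun q =>
    mul_nonneg (sub_nonneg.2 (Real.cos_le_one _)) (Real.exp_pos _).le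
  -- `ε > 0` almost everywhere on the Brillouin zone
  have hB : MeasurableSet (brillouin 2) := measurableSet_brillouin 2
  have hε_pos : ∀ᵐ p ∂μ, 0 < dispersion p := by
    have h_ne : ∀ᵐ p ∂μ, p ≠ (0 : Fin 2 → ℝ) := by
      have h0 : μ {(0 : Fin 2 → ℝ)} = 0 := by
        rw [hμ, Measure.restrict_apply (measurableSet_singleton 0)]
        exact measure_mono_null Set.inter_subset_left (measure_singleton 0)
      filter_upwards [measure_eq_zero_iff_ae_notMem.1 h0] with p hp
      simpa using hp
    filter_upwards [ae_restrict_mem hB, h_ne] with p hp hp0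
    exact dispersion_pos_of_mem_brillouin hp hp0
  -- the `t`-integrals for fixed `p`
  have hFp : ∀ p, 0 < dispersion p →
      Integrable (fun t => F (p, t)) ν ∧ ∫ t, F (p, t) ∂ν = potentialIntegrand x p := by
    intro p hp
    obtain ⟨hint, hval⟩ := integral_exp_neg_mul_Ioi' hp
    refine ⟨?_, ?_⟩
    · exact (hint.const_mul (1 - Real.cos (θ p)))
    · simp only [hF]
      rw [integral_const_mul, hν, hval, potentialIntegrand, div_eq_mul_inv]
  -- integrability of `F` on the product (Tonelli: the absolute double integral is `∫ (1-cos)/ε dp`)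
  have hpot : Integrable (potentialIntegrand x) μ := integrableOn_potentialIntegrand 2 x
  have hFint : Integrable F (μ.prod ν) := by
    rw [integrable_prod_iff hF_meas]
    refine ⟨?_, ?_⟩
    · filter_upwards [hε_pos] with p hp using (hFp p hp).1
    · refine hpot.congr ?_
      filter_upwards [hε_pos] with p hp
      rw [← (hFp p hp).2]
      exact integral_congr_ae (Eventually.of_forall fun t => (Real.norm_of_nonneg (hF_nonneg _)).symm)
  -- the inner `p`-integral for fixed `t`
  have hinner : ∀ t : ℝ, ∫ p, F (p, t) ∂μ =
      (2 * π) ^ 2 * (srwHeatKernel t 0 ^ 2 - srwHeatKernel t (x 0) * srwHeatKernel t (x 1)) := by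
    intro t
    simp only [hF, hθ, hμ]
    exact setIntegral_one_sub_cos_mul_exp_two t x
  have h2π : (0 : ℝ) < (2 * π) ^ 2 := by positivity
  refine ⟨?_, ?_⟩
  · -- integrability of the `t`-integrand
    have h := hFint.integral_prod_right
    have h' : Integrable (fun t => ((2 * π) ^ 2)⁻¹ * ∫ p, F (p, t) ∂μ) ν := h.const_mul _
    refine h'.congr (Eventually.of_forall fun t => ?_)
    simp only [hinner]
    field_simp
  · -- the representation
    have hG1 : latticePotentialKernel 2 x = (∫ p, ∫ t, F (p, t) ∂ν ∂μ) / (2 * π) ^ 2 := by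
      rw [latticePotentialKernel_eq]
      congr 1
      refine integral_congr_ae ?_
      filter_upwards [hε_pos] with p hp
      rw [(hFp p hp).2]
    rw [hG1, integral_integral_swap hFint]
    simp_rw [hinner]
    rw [integral_const_mul]
    field_simp

end Literature.Probability.LatticeModels
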